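import Literature.NumberTheory.EllipticCurves.NeronModelSchematic
import Literature.NumberTheory.EllipticCurves.NeronModelGluing
import Literature.NumberTheory.EllipticCurves.NeronModelUniqueProofs
import HarnessLib

/-!
# Gluing Néron models over two comaximal basic open sets (discharge of G2)

This file **proves** the named fact `exists_isNeronModel_of_away_of_away` of
`Literature.NumberTheory.EllipticCurves.NeronModelGluing` (fact "G2" of the existence programme
for Néron models, `NeronModelExistence`): if `(a, b) = R` in the Dedekind domain `R` with fraction
field `K` and the `K`-group scheme `E` has Néron models over (the models of) `R[1/a]` and `R[1/b]`,
then it has a Néron model over `R` (`exists_isNeronModel_of_away_of_away_holds`). With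
`NeronModelGluing` this leaves, below the gluing leaf `exists_isNeronModel_of_away_of_atPrime` of
`NeronModelExistence`, only the one-bad-prime fact
`exists_isNeronModel_of_away_of_atPrime_of_unique`.

## The proof (`exists_isNeronModel_of_away_of_away_of_ne_zero`)

For `a, b ≠ 0` take the models `Rₐ = R[1/a]`, `R_b = R[1/b]` and `R_ab = Rₐ[1/b]` (a model of
`R[1/ab]`, an `Rₐ`- and an `R_b`-algebra, Mathlib `IsLocalization.Away.commutes`), Néron models
`Nₐ / Rₐ`, `N_b / R_b` (hypotheses), their restrictions to `R_ab` (Néron models by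
`IsNeronModel.pullback_away` of `NeronModelBaseChange`) and the isomorphism
`ψ : Nₐ|_{R_ab} ≅ N_b|_{R_ab}` given by uniqueness (`IsNeronModel.exists_iso_of_isNeronModel_holds`,
`NeronModelUniqueProofs`). Glue the *schemes* `Nₐ`, `N_b` along the open immersions
`Nₐ ← Nₐ|_{R_ab} → N_b` (Mathlib's pushout of schemes along open immersions) and map the result
`𝒩` to `Spec R`. The preimage of `D(a)` in `𝒩` is the chart `Nₐ` (a point of the chart `N_b` over
`D(a)` lies over `D(ab)`, hence in the image of `Nₐ|_{R_ab}`; `preimage_desc_eq_range_inl` of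
`NeronModelSchematic`), so `Nₐ ≅ 𝒩 ×_R Rₐ` (Mathlib `IsOpenImmersion.isPullback`) and likewise
`N_b ≅ 𝒩 ×_R R_b`. Hence the restrictions of `𝒩` to `D(a)` and `D(b)` are Néron models in the
group-free sense, over every model of `R[1/a]`, `R[1/b]`
(`IsSchematicNeronModel.of_isLocalization_away`); by the local nature of the Néron property
(`IsSchematicNeronModel.of_localization_away`, `NeronModelLocal`) `𝒩` is a Néron model of `E` over
`R` in the group-free sense, and its group structure making it a Néron model in the sense of
`IsNeronModel` is automatic (`IsSchematicNeronModel.exists_grp`, BLR Prop. 1.2/6,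
`NeronModelGroupStructure`). If `a = 0` (or `b = 0`) then `b` (or `a`) is a unit and the
hypothesis over `R[1/b] = R` already is the conclusion.

## References

* S. Bosch, W. Lütkebohmert, M. Raynaud, *Néron Models*, Springer 1990, §1.2 (Prop. 4: local
  nature; Prop. 6: group structure), §1.4. [BLRNeronModels1990]
* J. H. Silverman, *Advanced Topics in the Arithmetic of Elliptic Curves*, GTM 151, 1994, proof of
  Thm. IV.6.1, p. 340 (the gluing sentence, for elliptic curves). [SilvermanATAEC1994]
-/

noncomputable section

universe u

namespace Literature.NumberTheory.EllipticCurves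

open AlgebraicGeometry CategoryTheory Limits
open scoped CategoryTheory.Obj

/-! ### Gluing two Néron models over comaximal basic open sets -/

section TwoOpens

variable {R : Type u} [CommRing R] {K : Type u} [Field K] [Algebra R K] [IsFractionRing R K]
  (E : Over (Spec (.of K))) [GrpObj E]

/-- **Gluing Néron models over two comaximal basic open sets, main case.** Let `R → K` be a
domain with its fraction field, `E` a `K`-group scheme, `a, b ≠ 0` with `(a, b) = R`. If `E` has
Néron models over the models of `R[1/a]` and of `R[1/b]`, it has a Néron model over `R`: glue the
two models (as schemes, along the uniqueness isomorphism of their restrictions to `R[1/ab]`) by a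
pushout along open immersions, identify the charts with the restrictions of the glued scheme to
`D(a)`, `D(b)`, conclude by the local nature of the Néron property and the automatic group
structure (see the module docstring).
[cite: BLRNeronModels1990, §1.2 (local nature of the Néron property) and §1.4] -/
theorem exists_isNeronModel_of_away_of_away_of_ne_zero (a b : R) (ha : a ≠ 0) (hb : b ≠ 0)
    (hab : Ideal.span {a, b} = ⊤)
    (HA : ∀ (R' : Type u) [CommRing R'] [Algebra R R'] [IsLocalization.Away a R'] [Algebra R' K]
      [IsScalarTower R R' K], ∃ 𝒩 : Grp (Over (Spec (.of R'))), IsNeronModel R' K 𝒩.X E)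
    (HB : ∀ (R' : Type u) [CommRing R'] [Algebra R R'] [IsLocalization.Away b R'] [Algebra R' K]
      [IsScalarTower R R' K], ∃ 𝒩 : Grp (Over (Spec (.of R'))), IsNeronModel R' K 𝒩.X E) :
    ∃ 𝒩 : Grp (Over (Spec (.of R))), IsNeronModel R K 𝒩.X E := by
  -- units in `K`
  have haK : IsUnit (algebraMap R K a) :=
    isUnit_iff_ne_zero.mpr ((map_ne_zero_iff _ (IsFractionRing.injective R K)).mpr ha)
  have hbK : IsUnit (algebraMap R K b) :=
    isUnit_iff_ne_zero.mpr ((map_ne_zero_iff _ (IsFractionRing.injective R K)).mpr hb)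
  -- the models `Rₐ = R[1/a]`, `R_b = R[1/b]` with their maps to `K`
  let Ra := Localization.Away a
  let Rb := Localization.Away b
  letI : Algebra Ra K := (IsLocalization.Away.lift a haK).toAlgebra
  haveI : IsScalarTower R Ra K :=
    IsScalarTower.of_algebraMap_eq fun x => (IsLocalization.Away.lift_eq a haK x).symm
  letI : Algebra Rb K := (IsLocalization.Away.lift b hbK).toAlgebra
  haveI : IsScalarTower R Rb K :=
    IsScalarTower.of_algebraMap_eq fun x => (IsLocalization.Away.lift_eq b hbK x).symm
  -- the model `R_ab = Rₐ[1/b]` of `R[1/ab]`, an `Rₐ`- and an `R_b`-algebra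
  let Rab := Localization.Away (algebraMap R Ra b)
  have hbRaK : IsUnit (algebraMap Ra K (algebraMap R Ra b)) := by
    rw [← IsScalarTower.algebraMap_apply]; exact hbK
  letI : Algebra Rab K := (IsLocalization.Away.lift (algebraMap R Ra b) hbRaK).toAlgebra
  haveI : IsScalarTower Ra Rab K :=
    IsScalarTower.of_algebraMap_eq (R := Ra) (S := Rab) (A := K) fun x =>
      (IsLocalization.Away.lift_eq (algebraMap R Ra b) hbRaK x).symm
  haveI : IsScalarTower R Rab K :=
    IsScalarTower.of_algebraMap_eq (R := R) (S := Rab) (A := K) fun x => by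
      rw [IsScalarTower.algebraMap_apply R Ra Rab x, ← IsScalarTower.algebraMap_apply Ra Rab K,
        ← IsScalarTower.algebraMap_apply R Ra K]
  have hbRab : IsUnit (algebraMap R Rab b) := by
    rw [IsScalarTower.algebraMap_apply R Ra Rab]
    exact IsLocalization.Away.algebraMap_isUnit (algebraMap R Ra b)
  letI : Algebra Rb Rab := (IsLocalization.Away.lift b hbRab).toAlgebra
  haveI : IsScalarTower R Rb Rab :=
    IsScalarTower.of_algebraMap_eq fun x => (IsLocalization.Away.lift_eq b hbRab x).symm
  haveI : IsScalarTower Rb Rab K := by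
    refine IsScalarTower.of_algebraMap_eq' ?_
    apply IsLocalization.ringHom_ext (Submonoid.powers b)
    rw [RingHom.comp_assoc, ← IsScalarTower.algebraMap_eq R Rb Rab, ← IsScalarTower.algebraMap_eq,
      ← IsScalarTower.algebraMap_eq]
  haveI : IsLocalization.Away (algebraMap R Rb a) Rab :=
    IsLocalization.Away.commutes (R := R) Rb Ra Rab b a
  -- the charts of the base
  haveI : IsOpenImmersion (specOfAlgebraMap R Ra) := IsOpenImmersion.of_isLocalization a
  haveI : IsOpenImmersion (specOfAlgebraMap R Rb) := IsOpenImmersion.of_isLocalization b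
  haveI : IsOpenImmersion (specOfAlgebraMap Ra Rab) :=
    IsOpenImmersion.of_isLocalization (algebraMap R Ra b)
  haveI : IsOpenImmersion (specOfAlgebraMap Rb Rab) :=
    IsOpenImmersion.of_isLocalization (algebraMap R Rb a)
  have hφ : specOfAlgebraMap Ra Rab ≫ specOfAlgebraMap R Ra =
      specOfAlgebraMap Rb Rab ≫ specOfAlgebraMap R Rb := by
    simp only [specOfAlgebraMap, ← Spec.map_comp, ← CommRingCat.ofHom_comp,
      ← IsScalarTower.algebraMap_eq]
  -- the two Néron models and their restrictions to `R_ab`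
  obtain ⟨Na, hNa⟩ := HA Ra
  obtain ⟨Nb, hNb⟩ := HB Rb
  have hNa' := hNa.pullback_away (R' := Rab) (algebraMap R Ra b)
  have hNb' := hNb.pullback_away (R' := Rab) (algebraMap R Rb a)
  obtain ⟨ψ, -⟩ := IsNeronModel.exists_iso_of_isNeronModel_holds hNa' hNb'
  -- glue the schemes `Na`, `Nb` along `Na|_{D(b)} ≅ Nb|_{D(a)}`
  let Na' : Over (Spec (.of Rab)) := (Over.pullback (specOfAlgebraMap Ra Rab)).obj Na.X
  let Nb' : Over (Spec (.of Rab)) := (Over.pullback (specOfAlgebraMap Rb Rab)).obj Nb.X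
  let fa : Na'.left ⟶ Na.X.left := pullback.fst Na.X.hom (specOfAlgebraMap Ra Rab)
  let fb : Nb'.left ⟶ Nb.X.left := pullback.fst Nb.X.hom (specOfAlgebraMap Rb Rab)
  let g : Na'.left ⟶ Nb.X.left := ψ.hom.left ≫ fb
  haveI hfa : IsOpenImmersion fa := by
    change IsOpenImmersion (pullback.fst Na.X.hom (specOfAlgebraMap Ra Rab)); infer_instance
  haveI hfb : IsOpenImmersion fb := by
    change IsOpenImmersion (pullback.fst Nb.X.hom (specOfAlgebraMap Rb Rab)); infer_instance
  haveI : IsIso ψ.hom.left := by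
    change IsIso ((Over.forget _).map ψ.hom); infer_instance
  haveI hψ : IsOpenImmersion ψ.hom.left := IsOpenImmersion.of_isIso _
  haveI hg : IsOpenImmersion g := @IsOpenImmersion.comp _ _ _ _ _ hψ hfb
  have h1 : fa ≫ Na.X.hom = Na'.hom ≫ specOfAlgebraMap Ra Rab := pullback.condition
  have h2 : fb ≫ Nb.X.hom = Nb'.hom ≫ specOfAlgebraMap Rb Rab := pullback.condition
  have h3 : ψ.hom.left ≫ Nb'.hom = Na'.hom := Over.w ψ.hom
  have w : fa ≫ Na.X.hom ≫ specOfAlgebraMap R Ra = g ≫ Nb.X.hom ≫ specOfAlgebraMap R Rb := by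
    calc fa ≫ Na.X.hom ≫ specOfAlgebraMap R Ra
        = (Na'.hom ≫ specOfAlgebraMap Ra Rab) ≫ specOfAlgebraMap R Ra := by
          rw [← Category.assoc, h1]
      _ = Na'.hom ≫ specOfAlgebraMap Rb Rab ≫ specOfAlgebraMap R Rb := by
          rw [Category.assoc, hφ]
      _ = (ψ.hom.left ≫ Nb'.hom) ≫ specOfAlgebraMap Rb Rab ≫ specOfAlgebraMap R Rb := by rw [h3]
      _ = ψ.hom.left ≫ (fb ≫ Nb.X.hom) ≫ specOfAlgebraMap R Rb := by
          rw [h2, Category.assoc, Category.assoc]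
      _ = g ≫ Nb.X.hom ≫ specOfAlgebraMap R Rb := by
          simp only [g, Category.assoc]
  let X := pushout fa g
  let p : X ⟶ Spec (.of R) :=
    pushout.desc (Na.X.hom ≫ specOfAlgebraMap R Ra) (Nb.X.hom ≫ specOfAlgebraMap R Rb) w
  let 𝒩 : Over (Spec (.of R)) := Over.mk p
  haveI : IsOpenImmersion (pushout.inl fa g) :=
    Scheme.IsLocallyDirected.instIsOpenImmersionι (span fa g) WalkingSpan.left
  haveI : IsOpenImmersion (pushout.inr fa g) :=
    Scheme.IsLocallyDirected.instIsOpenImmersionι (span fa g) WalkingSpan.right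
  -- ranges: `D(a) ∩ D(b)` seen from the two charts
  have hra : Set.range (specOfAlgebraMap Ra Rab) =
      specOfAlgebraMap R Ra ⁻¹' Set.range (specOfAlgebraMap R Rb) := by
    rw [range_specOfAlgebraMap (algebraMap R Ra b) Rab, range_specOfAlgebraMap b Rb]
    ext q
    exact Iff.rfl
  have hrb : Set.range (specOfAlgebraMap Rb Rab) =
      specOfAlgebraMap R Rb ⁻¹' Set.range (specOfAlgebraMap R Ra) := by
    rw [range_specOfAlgebraMap (algebraMap R Rb a) Rab, range_specOfAlgebraMap a Ra]
    ext q
    exact Iff.rfl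
  -- chart `a`: `Na ≅ 𝒩 ×_R Rₐ`
  have Ha : pushout.inl fa g ≫ p = Na.X.hom ≫ specOfAlgebraMap R Ra := pushout.inl_desc _ _ _
  have Ha' : p ⁻¹ᵁ (specOfAlgebraMap R Ra).opensRange = (pushout.inl fa g).opensRange := by
    ext1
    refine preimage_desc_eq_range_inl fa g _ _ w (Set.range (specOfAlgebraMap R Ra)) ?_ ?_
    · intro y; exact ⟨Na.X.hom y, rfl⟩
    · intro z hz
      have hz' : z ∈ Set.range (pullback.fst Nb.X.hom (specOfAlgebraMap Rb Rab)) := by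
        rw [Scheme.Pullback.range_fst, hrb]
        exact hz
      obtain ⟨z', rfl⟩ := hz'
      refine ⟨ψ.inv.left z', ?_⟩
      change (ψ.inv.left ≫ ψ.hom.left ≫ fb) z' = fb z'
      rw [← Category.assoc, ← Over.comp_left, Iso.inv_hom_id, Over.id_left, Category.id_comp]
  have sqa : IsPullback Na.X.hom (pushout.inl fa g) (specOfAlgebraMap R Ra) p :=
    IsOpenImmersion.isPullback _ _ _ _ Ha Ha'
  let ea : Na.X ≅ (Over.pullback (specOfAlgebraMap R Ra)).obj 𝒩 :=
    Over.isoMk sqa.flip.isoPullback sqa.flip.isoPullback_hom_snd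
  have hNa𝒩 : IsSchematicNeronModel Ra K ((Over.pullback (specOfAlgebraMap R Ra)).obj 𝒩) E :=
    hNa.isSchematicNeronModel.of_iso_left ea
  -- chart `b`: `Nb ≅ 𝒩 ×_R R_b`
  have Hb : pushout.inr fa g ≫ p = Nb.X.hom ≫ specOfAlgebraMap R Rb := pushout.inr_desc _ _ _
  have Hb' : p ⁻¹ᵁ (specOfAlgebraMap R Rb).opensRange = (pushout.inr fa g).opensRange := by
    ext1
    refine preimage_desc_eq_range_inr fa g _ _ w (Set.range (specOfAlgebraMap R Rb)) ?_ ?_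
    · intro z; exact ⟨Nb.X.hom z, rfl⟩
    · intro y hy
      change y ∈ Set.range (pullback.fst Na.X.hom (specOfAlgebraMap Ra Rab))
      rw [Scheme.Pullback.range_fst, hra]
      exact hy
  have sqb : IsPullback Nb.X.hom (pushout.inr fa g) (specOfAlgebraMap R Rb) p :=
    IsOpenImmersion.isPullback _ _ _ _ Hb Hb'
  let eb : Nb.X ≅ (Over.pullback (specOfAlgebraMap R Rb)).obj 𝒩 :=
    Over.isoMk sqb.flip.isoPullback sqb.flip.isoPullback_hom_snd
  have hNb𝒩 : IsSchematicNeronModel Rb K ((Over.pullback (specOfAlgebraMap R Rb)).obj 𝒩) E :=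
    hNb.isSchematicNeronModel.of_iso_left eb
  -- the Néron property is local on the base; the group structure comes for free
  let av : Bool → R := fun i => Bool.rec b a i
  have hav : Set.range av = {a, b} := by
    ext r
    simp only [Set.mem_range, Set.mem_insert_iff, Set.mem_singleton_iff, Bool.exists_bool, av]
    tauto
  have hspan : Ideal.span (Set.range av) = ⊤ := by rw [hav]; exact hab
  have hne : ∀ i, av i ≠ 0 := by rintro (_ | _) <;> assumption
  have H : ∀ (i : Bool) (R' : Type u) [CommRing R'] [Algebra R R'] [IsLocalization.Away (av i) R']
      [Algebra R' K] [IsScalarTower R R' K],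
      IsSchematicNeronModel R' K ((Over.pullback (specOfAlgebraMap R R')).obj 𝒩) E := by
    rintro (_ | _) R' _ _ _ _ _
    · exact hNb𝒩.of_isLocalization_away b Rb R'
    · exact hNa𝒩.of_isLocalization_away a Ra R'
  obtain ⟨𝒢, -, h𝒢⟩ := (IsSchematicNeronModel.of_localization_away av hspan hne H).exists_grp
  exact ⟨𝒢, h𝒢⟩

/-- **Discharge of `exists_isNeronModel_of_away_of_away`** (fact G2 of `NeronModelGluing`;
Bosch–Lütkebohmert–Raynaud, *Néron Models*, §1.2, Prop. 4 and §1.4; for elliptic curves the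
gluing sentence of Silverman, *ATAEC*, proof of Thm. IV.6.1, p. 340): over a Dedekind domain `R`
with fraction field `K`, a `K`-group scheme with Néron models over (the models of) `R[1/a]` and
`R[1/b]`, `(a, b) = R`, has a Néron model over `R`. The degenerate cases `a = 0` or `b = 0` (then
the other element is a unit) are immediate; otherwise
`exists_isNeronModel_of_away_of_away_of_ne_zero`.
[cite: BLRNeronModels1990, §1.2 (local nature of the Néron property) and §1.4] -/
theorem exists_isNeronModel_of_away_of_away_holds : exists_isNeronModel_of_away_of_away.{u} := by
  intro R _ _ K _ _ _ E _ a b hab HA HB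
  by_cases ha : a = 0
  · subst ha
    have hb : IsUnit b := by
      simpa [Ideal.span_insert, Ideal.span_singleton_eq_top] using hab
    exact HB.exists_of_isUnit_self hb
  by_cases hb : b = 0
  · subst hb
    have ha' : IsUnit a := by
      simpa [Ideal.span_insert, Ideal.span_singleton_eq_top] using hab
    exact HA.exists_of_isUnit_self ha'
  exact exists_isNeronModel_of_away_of_away_of_ne_zero E a b ha hb hab HA HB

end TwoOpens

end Literature.NumberTheory.EllipticCurves

end
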